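import Summits.QuantumFields.YangMills.Theorems.BalabanUVNodesN11K0DoorAtCRLetteredNumericsZB
import Summits.QuantumFields.YangMills.Theorems.BalabanUVNodesN11CRLetteredMemberLettersZ
import Summits.QuantumFields.YangMills.Theorems.BalabanUVNodesN11CRLetteredMemberLetters
import Summits.QuantumFields.YangMills.Theorems.BalabanUVNodesN11SupplyChainAtCRLetteredNumericsZ
import Summits.QuantumFields.YangMills.Theorems.BalabanUVNodesN11SupplyChainAtCRLetteredMemberOfBgFactsB

/-!
# DAG node N11 — N11's ONE-TOKEN RESIDUAL `SupplyChainAt`, THEOREM 1 OF [III] AND THE THEOREM OF p. 245 IN LAW FORM ON THE GUARD-FREE bg ROAD AT THE cR-LETTERED z-MEMBER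
# `θ₁₃ᶻ(n_c, ε₂₉; Efl, logz) = theta13LiveOfNumericsZ F N n_c ε₂₉ ζ Rz Zt Efl logz`, PER WINDOW RUN; door editions KEY INCLUDED; «γ sufficiently small» quantified —
# this seat's p631283 RE-ISSUED BY TOKEN-PASS at DEF-1's Z family (№218 (3))

HEADER — WORK-UNIT METADATA.  Cell `pub-ymgap`, YM-PLAN Track A (HUMAN RULING D-0062 ∕ D-0149 width seats), seat `pub-ymgap-dag-n11-w3` (g5; WIDTH SEAT 3∕4 on NODE n11 [B14]),
route `BalabanUVNodes` rev 29, item K1⁹ `StabilityBRunRowsAtRecordR13SepCoPHV` = stmt-QuantumFields-27364 (helper lane `--kind proof --supports 27364 --as helper`, count-neutral) ·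
FLAG №9 z-witness re-key (director-ym №218 (3): «consumers re-key by token-pass, one declarer per OWN file»).  [III] = [Balaban1988Convergent], [15] = [Balaban1985Variational],
[I] = [Balaban1987RG1], [IV] = [Balaban1989LargeFieldI], [B7] = [Balaban1985Averaging], [6] = [Balaban1985RegularSpaces].  Over (BY NAME): this seat's Z-b p∙ `…K0DoorAtCRLetteredNumericsZ`
(`bgFacts_ccmwCRZH_of_thm1GaugeR_of_hcomp_of_hjm` — the `hbgs` binder at the z-member, via dag-n11-w5 g3's witness-agnostic socket p638031; `hcompBoth_ccmwCRZ_of_betaBoxSignFree`;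
★★★★ `provisos₁₃SepCoPH_door_ccmwCRZ_of_gauge9TopStepR_of_betaBoxSignFree_allTorus`), Z-a p643546 `…SupplyChainAtCRLetteredNumericsZ` (`two_le_cR_of_ccmwCRZH`, `numericRows_of_ccmwCRZH`),
g4 p619867 (`ccmwCR_pos`, θ-free), dag-n11-w1 H3 p626869 (`supplyChainAt_of_gaussCert_of_supplierBorel_of_bgFacts_of_powM`), dag-n11-e (`sLaw₁₃CoPH_all_of_supplyChainAt`,
`thmP245Laws_of_supplyChainAt`), DEF-1 Z2 (`theta13LiveOfNumericsZ`, `admissible_theta13OfNumericsZ`), g3 p608030 (`exists_window_ccmShape`).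

WHY THIS FILE.  p631283 gave N11's token and laws at the cR-lettered W-member per window run from the key + K0's solvability + the supplier + Part 14 §0c's letters — no run guard.  The K1
door now re-keys to DEF-1's z-witness `theta13OfThm1CCMWZ … Efl logz` (FLAG №9), where LOCATED-cR persists (`cR = 1`: the BorelB ∕ bg road is `2 ≤ cR`-vacuous at the z-witness).  THIS
FILE is p631283's token-pass to the cR-lettered z-MEMBER: per window run, at `c ∈ [2, 8]`, N11's token and Theorem 1 ∕ p. 245 laws from the KEY, K0's per-cube [15]-solvability along the
run, [III] §3's supplier at the run, and Part 14 §0c's letters AT THE z-WITNESS ((8), the (9)-step, the sign-free β-box of `betaOfRecord₁₃ F N θ₁₅ᶜᶜᴹᵂᶻ(j; γ; Efl, logz)`) — NOTHING ELSE; at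
the z-member's history-blind door the key itself is Z-b's door theorem.  Proofs = p631283's VERBATIM under the token pass.

SIBLING MODULE (director-ym №365 RENAME-AND-REDIRECT, 2026-08-30): this is `…BalabanUVNodesN11SupplyChainAtCRLetteredMemberOfBgFactsZB`, the residue-free sibling of `…BalabanUVNodesN11SupplyChainAtCRLetteredMemberOfBgFactsZ` — SAME short decl names, the displayed [15]
hypotheses re-typed to the ᴮ tokens (dag-n11-w1's R-road convention `(floorGuard F c₁₅, lamDatum F, Dat)` + ONE data-transfer binder `hDat₀`) and the Stage-2 SEAM displayed as ONE
hypothesis `hseam` (so the file is green BEFORE and AFTER node00-def-R's seam edit; post-seam users pass `fun _ _ _ _ _ => by rw [UbgOfRecord₁₃CoP_succ]`); imports re-pointed to the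
residue-free twins `…K0DoorAtCRLetteredNumerics{,Z}B` ∕ `…BgRowGaugeRAtCRLetteredMemberB`, the letters bundles `…CRLetteredMemberLetters{,Z}` and the lower siblings.  The old module
is NOT edited (residue after the seam, R556 attic).  Count-neutral; nothing of Bałaban asserted.
WHAT THIS FILE PROVES (5 theorems, 0 `def`, 0 `sorry`; standard axioms).
§1 ★★★ `supplyChainAt_gaussPinH_of_ccmwCRZH_of_supplierBorel_of_betaBox` · ★★★ `thmP245Laws_gaussPinH_of_ccmwCRZH_of_supplierBorel_of_betaBox` (generic key);
§2 ★★★★ `supplyChainAt_gaussPinH_door_ccmwCRZ_of_supplierBorel_of_betaBox` · ★★★★ `thmP245Laws_gaussPinH_door_ccmwCRZ_of_supplierBorel_of_betaBox` (door, key included);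
§3 ★★★★ `exists_window_thmP245Laws_gaussPinH_door_ccmwCRZ` (∃ γ₁₁ⁿᵘᵐ(L, j, N) > 0).

HONEST FRAMING ∕ A6.  Helper lane, count-neutral token-pass of LANDED kernel bookkeeping of this seat's lineage; nothing of Bałaban asserted.  DISPLAYED (hypotheses, NOT discharged,
inhabited nowhere in the tree): (8) `VariationalThm1RegSepCoP7M`, the (9)-step `Gauge9RegSepTopStepR` (§1: `VariationalThm1GaugeRegSepCoP7MR`), the sign-free β-box at the z-witness with
`−bₗ·γ² ≤ 3`, `β′·γ² ≤ ¾`, K0's per-cube [15]-solvability, [III] §3's supplier (`SupplierObligations ∧ SupplierBorel` — XL), §1's key at the z-member.  NO value of `E_k ∕ log z_k` pinned or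
read (`Efl`, `logz` letters); NOT a claim that the z-member is K1⁹'s witness; FLAG №9 NOT closed by this.  Non-wrapping families only (`j + 1 ≤ F.m`).  NOT a re-pin (no `def`); N11 NOT
discharged; K0⁷ ∕ K1⁹ NOT closed, no stub touched; counts unmoved (typed 28∕28 · discharged 5∕27 · A 5∕28).  One finite `𝕋⁴_{L^K}` programme at fixed `ε = L^{−K}`;
`route-QuantumFields-BalabanUVNodes` closes ONLY the CONDITIONAL finite-𝕋⁴ rung `BalabanLadder.UV` — NOT ℝ⁴, NOT OS, NOT the Yang–Mills mass gap (Clay).  No `sorry`, no `axiom`, no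
`def`, no `instance`, no `notation`.
Sources (SHAPE only): [III] Thm 1 p.262, Theorem p.245, remark p.262, §3 p.279, (1.15) p.249, (2.4)–(2.8) pp.255–256, (2.10) p.256, (2.16)–(2.18) p.257, (2.28) p.259, (3.16)–(3.25)
pp.268–270; [15] (6)–(7) p.278, Thm 1 (7)–(9) pp.278–279, (144)–(152) pp.300–301, Prop. 8 p.304; [6] (1.3)–(1.9) p.77; [I] Thm 1 p.259, (0.20) p.256, (1.12) p.262, (1.20)–(1.22)
p.264; [B7] Prop. 2 p.26; [IV] (0.2)–(0.4) p.176, p.177 (i)–(ii).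
-/

noncomputable section

open MeasureTheory
open scoped BigOperators ENNReal NNReal Matrix.Norms.L2Operator

namespace Summit.QuantumFields.YangMills.Theorems.BalabanUVNodesN11SupplyChainAtCRLetteredMemberOfBgFactsZB

open Literature.MathematicalPhysics.QuantumFieldTheory.Balaban1983to89 T4Continuum T4NestedCovariance Node00 Node00.Tk DagBinding
open B15DeterminingSets B8Eq17ClassAkV1 B14.Eq218Concrete B10Eq42TorusConstraint FlowStep FlowStepRuns
open B14.Eq213MaximalDomains (side)
open B14.Eq213DetSet (Bj)
open Literature.MathematicalPhysics.QuantumFieldTheory.BalabanImbrieJaffe1984to88.BIJ85Eq453GaugeField (qsstarGIter0)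
open BalabanUVNodesN11HistoryPinnedResidualDefs BalabanUVNodesN11RePinnedParamDefs
open BalabanUVNodesN11GaussianCertificateDefs (gaussPinH gaussPinH_ζ0 gaussPinH_quad provisos₁₃CoPH_gaussPinH)
open BalabanUVNodesN11Sect3SupplyChainDefs
open BalabanUVNodesN11Sect3SupplyChainBorelB
open BalabanUVNodesN11Sect3SupplyChainObligationsDefs
open BalabanUVNodesN11Sect3SupplyChainBorelBOfBgFacts (supplyChainAt_of_gaussCert_of_supplierBorel_of_bgFacts_of_powM)
open BalabanUVNodesN11SupplyChainAtCRLetteredNumerics (ccmwCR_pos)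
open BalabanUVNodesN11SupplyChainAtCRLetteredNumericsZ (two_le_cR_of_ccmwCRZH numericRows_of_ccmwCRZH)
open BalabanUVNodesN11K0DoorAtCRLetteredNumericsZB (hAdm_floorGuard_ccmwCRZ provisos₁₃SepCoPH_door_ccmwCRZ_of_gauge9TopStepGB_of_betaBoxSignFree_allTorus_lam bgFacts_ccmwCRZH_of_thm1GaugeGB_of_hcomp_of_hjm_lam hadm_floorGuard_ccmwCRZ)
open BalabanUVNodesN11CRLetteredMemberLettersZ (letters_ccmwCRZ)
open BalabanUVNodesN11CRLetteredMemberLetters (letters_ccmwCR)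
open BalabanUVNodesN11NoExpansionNumericsAtThm1CCMW (exists_window_ccmShape)

variable {F : T4Family} {N : ℕ} [NeZero N] {Dat : TopData F N}

/-! ## §1  At any H-extension of the member, generic key: the token and the laws per window run -/

section Generic

variable {j c₁₅ : ℕ} {γ c ε₀ ε₂₉ B₃ B₃' a₀ a₁ bl β' : ℝ} {Efl logz : B12.RunParams → ℕ → ℝ} {θ : Stage13HParams F N}

/-- **★★★ N11's ONE-TOKEN RESIDUAL `SupplyChainAt (gaussPinH θ) p` ON THE GUARD-FREE bg ROAD AT THE cR-LETTERED z-MEMBER, PER WINDOW RUN**: for `θ` any H-extension of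
`θ₁₃ᶻ(n_c, ε₂₉; Efl, logz)` at the record pins, `2 ≤ c ≤ 8`, `1 ≤ j`, `j + 1 ≤ F.m`, `γ` meeting the four γ-conditions and `γ ≤ e^{−1}`, [15]'s signs, (8), (9) `VariationalThm1GaugeRegSepCoP7MR … (F.L^j) c₁₅ …`,
the sign-free windowed β-box of `betaOfRecord₁₃ F N θ₁₅ᶜᶜᴹᵂᶻ(j; γ; Efl, logz)` (Part 14 §0c's letters; `c`-blind): on every run `p` in the window `]0, γ]`, from the key `θ.Provisos₁₃SepCoPH`, K0's
per-cube [15]-solvability along the run and a [III] §3 supplier at the certificate with `SupplierObligations ∧ SupplierBorel` — NOTHING ELSE — the token.  dag-n11-w1 H3 at `gaussPinH θ`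
with `hcR`, `hM₁ ∕ hle`, admissibility, nesting, `M = L^j`, the five rows (g4) and ★ `hbgs` (dag-n11-w5 §3, (hcomp) ∧ (hcompRev) by g4's `hcompBoth_ccmwCRZ_of_betaBoxSignFree`) ALL SUPPLIED;
NO `PartCompat₁₃` anywhere (the guard-free twin of g4's `supplyChainAt_gaussPinH_of_ccmwCRZH_of_supplierBorel_of_solvable`).
[cite: Balaban1988Convergent, Thm 1 p.262, Theorem p.245, §3 p.279, (2.4)–(2.8) pp.255–256, (2.10) p.256, (2.16)–(2.18) p.257, (2.28) p.259, (3.24)–(3.25) p.270; Balaban1985Variational, (6)–(7) p.278, Thm 1 (7)–(9) pp.278–279; Balaban1985Averaging, Prop. 2 p.26; Balaban1987RG1, Thm 1 p.259, (0.20) p.256, (1.12) p.262, (1.20)–(1.22) p.264; Balaban1989LargeFieldI, (0.3)–(0.4) p.176] -/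
theorem supplyChainAt_gaussPinH_of_ccmwCRZH_of_supplierBorel_of_betaBox
    (hθ : θ.toStage13Params = theta13LiveOfNumericsZ F N
      ({ stage12NumericsOfThm1CCMW F.L j γ ε₀ B₃ B₃' a₀ a₁ with s2 := { sect2NumericsOfThm1C F.L with cR := c } } : Stage12Numerics) ε₂₉
      (zeta316OfRecord F N (stage12NumericsOfThm1CCMW F.L j γ ε₀ B₃ B₃' a₀ a₁).ν (stage12NumericsOfThm1CCMW F.L j γ ε₀ B₃ B₃' a₀ a₁).τ9.M
        (stage12NumericsOfThm1CCMW F.L j γ ε₀ B₃ B₃' a₀ a₁).A₁) (RzOfRecord F N) (ZtOfRecord F N) Efl logz)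
    (hjm : j + 1 ≤ F.m) (hc2 : 2 ≤ c) (hc8 : c ≤ 8) (hj : 1 ≤ j) (hε : 0 < ε₀) (hε' : 0 < ε₂₉) (hB : 0 ≤ B₃) (hB' : 0 ≤ B₃') (ha₀ : 0 < a₀) (ha₁ : 0 < a₁)
    (hγ0 : 0 < γ) (hγe : γ ≤ Real.exp (-1))
    (h3γ : 3 * (F.L : ℝ) ^ j ≤ F.L * Real.log (γ ^ 2)⁻¹) (hRγ : ((8 * F.L + 3 : ℕ) : ℝ) ≤ F.L * Real.log (γ ^ 2)⁻¹)
    (hε3γ : 36608 * (γ * Real.log (γ ^ 2)⁻¹) ≤ 16 / 3) (hε2γ : γ * Real.log (γ ^ 2)⁻¹ ≤ 16 * ExpMeanLog.deltaSU (Fin N) / ((8 * F.L : ℕ) : ℝ) ^ 2)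
    (h15 : VariationalThm1RegSepCoP7MGB F N (floorGuard F c₁₅) (lamDatum F) Dat B₃ a₀ a₁) (hc₁₅ : c₁₅ ≤ F.L ^ j) (h15G : VariationalThm1GaugeRegSepCoP7MGB F N (F.L ^ j) (floorGuard F c₁₅) (lamDatum F) Dat B₃ B₃' a₀ a₁)
    (hDat₀ : ∀ (θ' : Stage13Params F N) (p : B12.RunParams) (n : ℕ) (s : SeqOfRecord F θ'.ν θ'.τ9.M (gOfRecord₁₃ F N θ' p) p.K n) (δ : ℕ → ℝ) (W : MSField (F.P p.K) (SU N)),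
      n ≤ p.K → Sect2.DataSmall7PTop (avOfRecord F N p.K) s.Ω (suppDomOfRecord F θ'.ν p.K s.Ω) n δ W → Dat p.K s.Ω (suppDomOfRecord F θ'.ν p.K s.Ω) n δ W)
    (hseam : ∀ (θ' : Stage13Params F N) (p : B12.RunParams) (n : ℕ) (s : SeqOfRecord F θ'.ν θ'.τ9.M (gOfRecord₁₃ F N θ' p) p.K (n + 1)) (W : MSField (F.P p.K) (SU N)),
      UbgOfRecord₁₃CoP F N θ' p (n + 1) s W = UbgMSCoPOfRecordB F N θ'.ν θ'.τ9.M (gOfRecord₁₃ F N θ' p) p.K (n + 1) s W)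
    (hbox : BetaLowerH bl γ (betaOfRecord₁₃ F N (theta13OfThm1CCMWZ F N j γ ε₀ ε₂₉ B₃ B₃' a₀ a₁ Efl logz)))
    (hbox' : BetaUpperH β' γ (betaOfRecord₁₃ F N (theta13OfThm1CCMWZ F N j γ ε₀ ε₂₉ B₃ B₃' a₀ a₁ Efl logz))) (hl : -bl * γ ^ 2 ≤ 3) (hβ' : β' * γ ^ 2 ≤ 3 / 4)
    (h : θ.Provisos₁₃SepCoPH F N) (p : B12.RunParams) (hw : Step.InInterval γ p.K (gOfRecord₁₃ F N θ.toStage13Params p))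
    (hsolv : ∀ i, 1 ≤ i → i ≤ p.K → ∀ (s : SeqOfRecord F θ.toStage13Params.ν θ.toStage13Params.τ9.M (gOfRecord₁₃ F N θ.toStage13Params p) p.K i) (V : GaugeField (F.P p.K) i (SU N)),
      chiSeqOfRecord F N θ.toStage13Params.ν θ.toStage13Params.τ9.M (gOfRecord₁₃ F N θ.toStage13Params p) p.K i s V ≠ 0 →
      ∀ a ∈ cubesIn (fun a : ↥(cubeIndices (F.P p.K) (cubeSide (F.P p.K).L θ.toStage13Params.ν.M₂ (RkOfRecord (F.P p.K).L θ.toStage13Params.ν.r (gOfRecord₁₃ F N θ.toStage13Params p i)) i)) =>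
          cubeEnl (F.P p.K) (cubeSide (F.P p.K).L θ.toStage13Params.ν.M₂ (RkOfRecord (F.P p.K).L θ.toStage13Params.ν.r (gOfRecord₁₃ F N θ.toStage13Params p i)) i) a 0) (s.Ω i),
        ∃ U₀, IsMinimizer (avOfRecord F N p.K) {U | PlaqSmall (θ.toStage13Params.ν.εreg * (F.P p.K).eta i ^ 2) U}
          (Bj θ.toStage13Params.ν.M₁ (cubeEnl (F.P p.K) (cubeSide (F.P p.K).L θ.toStage13Params.ν.M₂ (RkOfRecord (F.P p.K).L θ.toStage13Params.ν.r (gOfRecord₁₃ F N θ.toStage13Params p i)) i) a 4) i)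
          (avgFamily (avOfRecord F N p.K) (qsstarGIter0 i V)) U₀)
    (σ : Sect3Supplier (gaussPinH θ) p) (hσ : SupplierObligations (gaussPinH θ) p σ) (hσB : SupplierBorel (gaussPinH θ) p σ) :
    SupplyChainAt (gaussPinH θ) p := by
  have hγh : γ ≤ 1 / 2 := hγe.trans (Real.exp_neg_one_lt_d9.le.trans (by norm_num))
  -- the z-member's θ-level letters (g4), read BEFORE destructuring `θ`
  obtain ⟨h3, hR, hεr, hε3, hε2⟩ := numericRows_of_ccmwCRZH hθ hB hB' ha₀ ha₁ hγ0 hγe h3γ hRγ hε3γ hε2γ p hw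
  have hcR := two_le_cR_of_ccmwCRZH hθ hc2
  obtain ⟨⟨θ₁, Zr⟩, Zh, Phih⟩ := θ
  obtain rfl : θ₁ = _ := hθ
  -- (hcomp) ∧ (hcompRev) at the member from the sign-free β-box (g4), then the bg facts of the run WITHOUT the run guard (dag-n11-w5 §3)
  have H := (letters_ccmwCRZ (F := F) (N := N) (j := j) (c := c) (ε₀ := ε₀) (ε₂₉ := ε₂₉) (B₃ := B₃) (B₃' := B₃') (a₀ := a₀) (a₁ := a₁)
    (θ := theta13LiveOfNumericsZ F N ({ stage12NumericsOfThm1CCMW F.L j γ ε₀ B₃ B₃' a₀ a₁ with s2 := { sect2NumericsOfThm1C F.L with cR := c } } : Stage12Numerics) ε₂₉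
      (zeta316OfRecord F N (stage12NumericsOfThm1CCMW F.L j γ ε₀ B₃ B₃' a₀ a₁).ν (stage12NumericsOfThm1CCMW F.L j γ ε₀ B₃ B₃' a₀ a₁).τ9.M
        (stage12NumericsOfThm1CCMW F.L j γ ε₀ B₃ B₃' a₀ a₁).A₁) (RzOfRecord F N) (ZtOfRecord F N) Efl logz)
    rfl (by linarith) hc8 hγh hB hB' ha₀ ha₁).2.2.2.2.2.2.2.2.2 hbox hbox' hl hβ'
  have hbgs := bgFacts_ccmwCRZH_of_thm1GaugeGB_of_hcomp_of_hjm_lam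
    (θH := (⟨⟨theta13LiveOfNumericsZ F N ({ stage12NumericsOfThm1CCMW F.L j γ ε₀ B₃ B₃' a₀ a₁ with s2 := { sect2NumericsOfThm1C F.L with cR := c } } : Stage12Numerics) ε₂₉
      (zeta316OfRecord F N (stage12NumericsOfThm1CCMW F.L j γ ε₀ B₃ B₃' a₀ a₁).ν (stage12NumericsOfThm1CCMW F.L j γ ε₀ B₃ B₃' a₀ a₁).τ9.M
        (stage12NumericsOfThm1CCMW F.L j γ ε₀ B₃ B₃' a₀ a₁).A₁) (RzOfRecord F N) (ZtOfRecord F N) Efl logz, Zr⟩, Zh, Phih⟩ : Stage13HParams F N))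
    rfl rfl hjm (by linarith) hc8 hγ0 hγh hε hε' hB hB' ha₀ ha₁ h15 h15G (hadm_floorGuard_ccmwCRZ rfl hc₁₅) (fun p n s δ W hn _ h => hDat₀ _ p n s δ W hn h) hseam H.1 H.2 (γ' := γ) le_rfl
  have hγ1 : γ < 1 := hγh.trans_lt (by norm_num)
  have hpos := ccmwCR_pos (L := F.L) (j := j) (ε₀ := ε₀) (B₃ := B₃) (B₃' := B₃') (a₀ := a₀) (a₁ := a₁) (by have := F.hL11; omega) hγ0 hγ1
    (by linarith : (0 : ℝ) < c) hε hB hB' ha₀ ha₁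
  have hadm := (admissible_theta13OfNumericsZ (n := ({ stage12NumericsOfThm1CCMW F.L j γ ε₀ B₃ B₃' a₀ a₁ with s2 := { sect2NumericsOfThm1C F.L with cR := c } } : Stage12Numerics)) F N
    (zeta316OfRecord F N (stage12NumericsOfThm1CCMW F.L j γ ε₀ B₃ B₃' a₀ a₁).ν (stage12NumericsOfThm1CCMW F.L j γ ε₀ B₃ B₃' a₀ a₁).τ9.M
      (stage12NumericsOfThm1CCMW F.L j γ ε₀ B₃ B₃' a₀ a₁).A₁) (RzOfRecord F N) (ZtOfRecord F N) Efl logz hpos hε').liveRepin₁₃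
  refine supplyChainAt_of_gaussCert_of_supplierBorel_of_bgFacts_of_powM _ p (gaussPinH_ζ0 _) (gaussPinH_quad _) (provisos₁₃CoPH_gaussPinH h.toCore) hadm
    (show 0 < F.L ^ j from pow_pos (by have := F.hL11; omega) _) le_rfl hcR hw (hbgs p hw) ?_ (a := j) rfl h3 hR hεr hε3 hε2 hsolv σ hσ hσB
  show F.L * 1 ∣ F.L ^ j
  rw [mul_one]
  exact dvd_pow_self _ (by omega)

/-- **★★★ THEOREM 1 OF [III] ALONG THE RUN AND THE THEOREM OF p. 245 IN LAW FORM — `∀ k ≤ K, SLaw₁₃CoPH (gaussPinH θ) p k` and `∀ k < K, SLaw → TLaw` — ON THE GUARD-FREE bg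
ROAD AT THE cR-LETTERED z-MEMBER, PER WINDOW RUN** (the token above ∘ dag-n11-e's `sLaw₁₃CoPH_all_of_supplyChainAt` ∕ `thmP245Laws_of_supplyChainAt` on the live-selector line:
selector clause `rfl`, `κ = 2·10⁴`, `E₀ = B₀ = 1`, `M = L^j ≥ 1`).  The guard-free twin of g4's `thmP245Laws_gaussPinH_of_ccmwCRZH_of_supplierBorel_of_solvable`.
[cite: Balaban1988Convergent, Thm 1 p.262, Theorem p.245, remark p.262, §3 p.279, (3.24)–(3.25) p.270, (2.10) p.256, (2.28) p.259; Balaban1987RG1, Thm 1 p.259, (1.20)–(1.22) p.264; Balaban1989LargeFieldI, (0.3)–(0.4) p.176, p.177 (i)–(ii); Balaban1985Variational, Thm 1 (8)–(9) p.279] -/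
theorem thmP245Laws_gaussPinH_of_ccmwCRZH_of_supplierBorel_of_betaBox
    (hθ : θ.toStage13Params = theta13LiveOfNumericsZ F N
      ({ stage12NumericsOfThm1CCMW F.L j γ ε₀ B₃ B₃' a₀ a₁ with s2 := { sect2NumericsOfThm1C F.L with cR := c } } : Stage12Numerics) ε₂₉
      (zeta316OfRecord F N (stage12NumericsOfThm1CCMW F.L j γ ε₀ B₃ B₃' a₀ a₁).ν (stage12NumericsOfThm1CCMW F.L j γ ε₀ B₃ B₃' a₀ a₁).τ9.M
        (stage12NumericsOfThm1CCMW F.L j γ ε₀ B₃ B₃' a₀ a₁).A₁) (RzOfRecord F N) (ZtOfRecord F N) Efl logz)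
    (hjm : j + 1 ≤ F.m) (hc2 : 2 ≤ c) (hc8 : c ≤ 8) (hj : 1 ≤ j) (hε : 0 < ε₀) (hε' : 0 < ε₂₉) (hB : 0 ≤ B₃) (hB' : 0 ≤ B₃') (ha₀ : 0 < a₀) (ha₁ : 0 < a₁)
    (hγ0 : 0 < γ) (hγe : γ ≤ Real.exp (-1))
    (h3γ : 3 * (F.L : ℝ) ^ j ≤ F.L * Real.log (γ ^ 2)⁻¹) (hRγ : ((8 * F.L + 3 : ℕ) : ℝ) ≤ F.L * Real.log (γ ^ 2)⁻¹)
    (hε3γ : 36608 * (γ * Real.log (γ ^ 2)⁻¹) ≤ 16 / 3) (hε2γ : γ * Real.log (γ ^ 2)⁻¹ ≤ 16 * ExpMeanLog.deltaSU (Fin N) / ((8 * F.L : ℕ) : ℝ) ^ 2)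
    (h15 : VariationalThm1RegSepCoP7MGB F N (floorGuard F c₁₅) (lamDatum F) Dat B₃ a₀ a₁) (hc₁₅ : c₁₅ ≤ F.L ^ j) (h15G : VariationalThm1GaugeRegSepCoP7MGB F N (F.L ^ j) (floorGuard F c₁₅) (lamDatum F) Dat B₃ B₃' a₀ a₁)
    (hDat₀ : ∀ (θ' : Stage13Params F N) (p : B12.RunParams) (n : ℕ) (s : SeqOfRecord F θ'.ν θ'.τ9.M (gOfRecord₁₃ F N θ' p) p.K n) (δ : ℕ → ℝ) (W : MSField (F.P p.K) (SU N)),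
      n ≤ p.K → Sect2.DataSmall7PTop (avOfRecord F N p.K) s.Ω (suppDomOfRecord F θ'.ν p.K s.Ω) n δ W → Dat p.K s.Ω (suppDomOfRecord F θ'.ν p.K s.Ω) n δ W)
    (hseam : ∀ (θ' : Stage13Params F N) (p : B12.RunParams) (n : ℕ) (s : SeqOfRecord F θ'.ν θ'.τ9.M (gOfRecord₁₃ F N θ' p) p.K (n + 1)) (W : MSField (F.P p.K) (SU N)),
      UbgOfRecord₁₃CoP F N θ' p (n + 1) s W = UbgMSCoPOfRecordB F N θ'.ν θ'.τ9.M (gOfRecord₁₃ F N θ' p) p.K (n + 1) s W)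
    (hbox : BetaLowerH bl γ (betaOfRecord₁₃ F N (theta13OfThm1CCMWZ F N j γ ε₀ ε₂₉ B₃ B₃' a₀ a₁ Efl logz)))
    (hbox' : BetaUpperH β' γ (betaOfRecord₁₃ F N (theta13OfThm1CCMWZ F N j γ ε₀ ε₂₉ B₃ B₃' a₀ a₁ Efl logz))) (hl : -bl * γ ^ 2 ≤ 3) (hβ' : β' * γ ^ 2 ≤ 3 / 4)
    (h : θ.Provisos₁₃SepCoPH F N) (p : B12.RunParams) (hw : Step.InInterval γ p.K (gOfRecord₁₃ F N θ.toStage13Params p))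
    (hsolv : ∀ i, 1 ≤ i → i ≤ p.K → ∀ (s : SeqOfRecord F θ.toStage13Params.ν θ.toStage13Params.τ9.M (gOfRecord₁₃ F N θ.toStage13Params p) p.K i) (V : GaugeField (F.P p.K) i (SU N)),
      chiSeqOfRecord F N θ.toStage13Params.ν θ.toStage13Params.τ9.M (gOfRecord₁₃ F N θ.toStage13Params p) p.K i s V ≠ 0 →
      ∀ a ∈ cubesIn (fun a : ↥(cubeIndices (F.P p.K) (cubeSide (F.P p.K).L θ.toStage13Params.ν.M₂ (RkOfRecord (F.P p.K).L θ.toStage13Params.ν.r (gOfRecord₁₃ F N θ.toStage13Params p i)) i)) =>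
          cubeEnl (F.P p.K) (cubeSide (F.P p.K).L θ.toStage13Params.ν.M₂ (RkOfRecord (F.P p.K).L θ.toStage13Params.ν.r (gOfRecord₁₃ F N θ.toStage13Params p i)) i) a 0) (s.Ω i),
        ∃ U₀, IsMinimizer (avOfRecord F N p.K) {U | PlaqSmall (θ.toStage13Params.ν.εreg * (F.P p.K).eta i ^ 2) U}
          (Bj θ.toStage13Params.ν.M₁ (cubeEnl (F.P p.K) (cubeSide (F.P p.K).L θ.toStage13Params.ν.M₂ (RkOfRecord (F.P p.K).L θ.toStage13Params.ν.r (gOfRecord₁₃ F N θ.toStage13Params p i)) i) a 4) i)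
          (avgFamily (avOfRecord F N p.K) (qsstarGIter0 i V)) U₀)
    (σ : Sect3Supplier (gaussPinH θ) p) (hσ : SupplierObligations (gaussPinH θ) p σ) (hσB : SupplierBorel (gaussPinH θ) p σ) :
    (∀ k, k ≤ p.K → SLaw₁₃CoPH F N (gaussPinH θ) p k) ∧ (∀ k, k < p.K → SLaw₁₃CoPH F N (gaussPinH θ) p k → TLaw₁₃CoPH F N (gaussPinH θ) p k) := by
  have hN := supplyChainAt_gaussPinH_of_ccmwCRZH_of_supplierBorel_of_betaBox hθ hjm hc2 hc8 hj hε hε' hB hB' ha₀ ha₁ hγ0 hγe h3γ hRγ hε3γ hε2γ h15 hc₁₅ h15G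
    hDat₀ hseam hbox hbox' hl hβ' h p hw hsolv σ hσ hσB
  obtain ⟨⟨θ₁, Zr⟩, Zh, Phih⟩ := θ
  obtain rfl : θ₁ = _ := hθ
  have hγ1 : γ < 1 := hγe.trans_lt (Real.exp_lt_one_iff.mpr (by norm_num))
  have hpos := ccmwCR_pos (L := F.L) (j := j) (ε₀ := ε₀) (B₃ := B₃) (B₃' := B₃') (a₀ := a₀) (a₁ := a₁) (by have := F.hL11; omega) hγ0 hγ1
    (by linarith : (0 : ℝ) < c) hε hB hB' ha₀ ha₁
  have hadm := (admissible_theta13OfNumericsZ (n := ({ stage12NumericsOfThm1CCMW F.L j γ ε₀ B₃ B₃' a₀ a₁ with s2 := { sect2NumericsOfThm1C F.L with cR := c } } : Stage12Numerics)) F N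
    (zeta316OfRecord F N (stage12NumericsOfThm1CCMW F.L j γ ε₀ B₃ B₃' a₀ a₁).ν (stage12NumericsOfThm1CCMW F.L j γ ε₀ B₃ B₃' a₀ a₁).τ9.M
      (stage12NumericsOfThm1CCMW F.L j γ ε₀ B₃ B₃' a₀ a₁).A₁) (RzOfRecord F N) (ZtOfRecord F N) Efl logz hpos hε').liveRepin₁₃
  have hrec := provisos₁₃CoPH_gaussPinH h.toCore
  have hM : 1 ≤ F.L ^ j := Nat.one_le_pow _ _ (by have := F.hL11; omega)
  have hκ : (0 : ℝ) ≤ 20000 := by norm_num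
  exact ⟨sLaw₁₃CoPH_all_of_supplyChainAt hrec rfl hadm hκ zero_le_one zero_le_one hM hN,
    thmP245Laws_of_supplyChainAt hrec rfl hadm hκ zero_le_one zero_le_one hM hN⟩

end Generic

/-! ## §2  At the z-member's history-blind door, KEY INCLUDED (g4's door theorem): the token and the laws per window run -/

section Door

variable {j c₁₅ : ℕ} {γ c ε₀ ε₂₉ B₃ B₃' a₀ a₁ bl β' : ℝ} {Efl logz : B12.RunParams → ℕ → ℝ} {θ₀ : Stage13Params F N}

/-- **★★★★ N11's TOKEN PER WINDOW RUN AT THE z-MEMBER's HISTORY-BLIND DOOR, KEY INCLUDED**: at `θ := Stage13HParams.ofHistoryBlind F N ⟨θ₁₃ᶻ(n_c, ε₂₉; Efl, logz), ZrOfRecord₁₃ …⟩` the key is g4's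
door theorem `provisos₁₃SepCoPH_door_ccmwCRZ_of_gauge9TopStepR_of_betaBoxSignFree_allTorus` (Part 14 §0c's K0-side inputs VERBATIM + `0 < c ≤ 8`), so on every window run
`SupplyChainAt (gaussPinH θ) p` follows from: the window ∕ sign letters and the four γ-conditions, (8) `h15`, the (9)-step `h9`, the sign-free β-box, `2 ≤ c ≤ 8`, `1 ≤ j`, `j + 1 ≤ F.m`,
K0's per-cube [15]-solvability along the run and [III] §3's supplier at the run with `SupplierObligations ∧ SupplierBorel` — NOTHING ELSE (no key, no bg binder, no run guard, no numeric
row, no `hsel`).  CONDITIONAL; nothing of Bałaban asserted; NOT a discharge.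
[cite: Balaban1988Convergent, Thm 1 p.262, Theorem p.245, §3 p.279, (2.10) p.256, (2.28) p.259, (3.16)–(3.23) pp.268–270, (3.24)–(3.25) p.270; Balaban1985Variational, Thm 1 (7)–(9) pp.278–279, (144)–(152) pp.300–301, Prop. 8 p.304; Balaban1987RG1, Thm 1 p.259, (0.20) p.256, (1.20)–(1.22) p.264; Balaban1989LargeFieldI, (0.2)–(0.4) p.176] -/
theorem supplyChainAt_gaussPinH_door_ccmwCRZ_of_supplierBorel_of_betaBox
    (hθ₀ : θ₀ = theta13LiveOfNumericsZ F N
      ({ stage12NumericsOfThm1CCMW F.L j γ ε₀ B₃ B₃' a₀ a₁ with s2 := { sect2NumericsOfThm1C F.L with cR := c } } : Stage12Numerics) ε₂₉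
      (zeta316OfRecord F N (stage12NumericsOfThm1CCMW F.L j γ ε₀ B₃ B₃' a₀ a₁).ν (stage12NumericsOfThm1CCMW F.L j γ ε₀ B₃ B₃' a₀ a₁).τ9.M
        (stage12NumericsOfThm1CCMW F.L j γ ε₀ B₃ B₃' a₀ a₁).A₁) (RzOfRecord F N) (ZtOfRecord F N) Efl logz)
    (hjm : j + 1 ≤ F.m) (hc2 : 2 ≤ c) (hc8 : c ≤ 8) (hj : 1 ≤ j) (hε : 0 < ε₀) (hε' : 0 < ε₂₉) (hB : 0 ≤ B₃) (hB' : 0 ≤ B₃') (ha₀ : 0 < a₀) (ha₁ : 0 < a₁)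
    (hγ0 : 0 < γ) (hγe : γ ≤ Real.exp (-1))
    (h3γ : 3 * (F.L : ℝ) ^ j ≤ F.L * Real.log (γ ^ 2)⁻¹) (hRγ : ((8 * F.L + 3 : ℕ) : ℝ) ≤ F.L * Real.log (γ ^ 2)⁻¹)
    (hε3γ : 36608 * (γ * Real.log (γ ^ 2)⁻¹) ≤ 16 / 3) (hε2γ : γ * Real.log (γ ^ 2)⁻¹ ≤ 16 * ExpMeanLog.deltaSU (Fin N) / ((8 * F.L : ℕ) : ℝ) ^ 2)
    (h15 : VariationalThm1RegSepCoP7MGB F N (floorGuard F c₁₅) (lamDatum F) Dat B₃ a₀ a₁) (hc₁₅ : c₁₅ ≤ F.L ^ j)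
    (h9 : Gauge9RegSepTopStepGB F N (fun ν K Ω => suppDomOfRecord F ν K Ω) (F.L ^ j) (floorGuard F c₁₅) (lamDatum F) Dat B₃ B₃' a₀ a₁)
    (hDat₀ : ∀ (θ' : Stage13Params F N) (p : B12.RunParams) (n : ℕ) (s : SeqOfRecord F θ'.ν θ'.τ9.M (gOfRecord₁₃ F N θ' p) p.K n) (δ : ℕ → ℝ) (W : MSField (F.P p.K) (SU N)),
      n ≤ p.K → Sect2.DataSmall7PTop (avOfRecord F N p.K) s.Ω (suppDomOfRecord F θ'.ν p.K s.Ω) n δ W → Dat p.K s.Ω (suppDomOfRecord F θ'.ν p.K s.Ω) n δ W)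
    (hseam : ∀ (θ' : Stage13Params F N) (p : B12.RunParams) (n : ℕ) (s : SeqOfRecord F θ'.ν θ'.τ9.M (gOfRecord₁₃ F N θ' p) p.K (n + 1)) (W : MSField (F.P p.K) (SU N)),
      UbgOfRecord₁₃CoP F N θ' p (n + 1) s W = UbgMSCoPOfRecordB F N θ'.ν θ'.τ9.M (gOfRecord₁₃ F N θ' p) p.K (n + 1) s W)
    (hbox : BetaLowerH bl γ (betaOfRecord₁₃ F N (theta13OfThm1CCMWZ F N j γ ε₀ ε₂₉ B₃ B₃' a₀ a₁ Efl logz)))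
    (hbox' : BetaUpperH β' γ (betaOfRecord₁₃ F N (theta13OfThm1CCMWZ F N j γ ε₀ ε₂₉ B₃ B₃' a₀ a₁ Efl logz))) (hl : -bl * γ ^ 2 ≤ 3) (hβ' : β' * γ ^ 2 ≤ 3 / 4)
    (p : B12.RunParams) (hw : Step.InInterval γ p.K (gOfRecord₁₃ F N θ₀ p))
    (hsolv : ∀ i, 1 ≤ i → i ≤ p.K → ∀ (s : SeqOfRecord F θ₀.ν θ₀.τ9.M (gOfRecord₁₃ F N θ₀ p) p.K i) (V : GaugeField (F.P p.K) i (SU N)),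
      chiSeqOfRecord F N θ₀.ν θ₀.τ9.M (gOfRecord₁₃ F N θ₀ p) p.K i s V ≠ 0 →
      ∀ a ∈ cubesIn (fun a : ↥(cubeIndices (F.P p.K) (cubeSide (F.P p.K).L θ₀.ν.M₂ (RkOfRecord (F.P p.K).L θ₀.ν.r (gOfRecord₁₃ F N θ₀ p i)) i)) =>
          cubeEnl (F.P p.K) (cubeSide (F.P p.K).L θ₀.ν.M₂ (RkOfRecord (F.P p.K).L θ₀.ν.r (gOfRecord₁₃ F N θ₀ p i)) i) a 0) (s.Ω i),
        ∃ U₀, IsMinimizer (avOfRecord F N p.K) {U | PlaqSmall (θ₀.ν.εreg * (F.P p.K).eta i ^ 2) U}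
          (Bj θ₀.ν.M₁ (cubeEnl (F.P p.K) (cubeSide (F.P p.K).L θ₀.ν.M₂ (RkOfRecord (F.P p.K).L θ₀.ν.r (gOfRecord₁₃ F N θ₀ p i)) i) a 4) i)
          (avgFamily (avOfRecord F N p.K) (qsstarGIter0 i V)) U₀)
    (σ : Sect3Supplier (gaussPinH (Stage13HParams.ofHistoryBlind F N ⟨θ₀, ZrOfRecord₁₃ F N θ₀⟩)) p)
    (hσ : SupplierObligations (gaussPinH (Stage13HParams.ofHistoryBlind F N ⟨θ₀, ZrOfRecord₁₃ F N θ₀⟩)) p σ)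
    (hσB : SupplierBorel (gaussPinH (Stage13HParams.ofHistoryBlind F N ⟨θ₀, ZrOfRecord₁₃ F N θ₀⟩)) p σ) :
    SupplyChainAt (gaussPinH (Stage13HParams.ofHistoryBlind F N ⟨θ₀, ZrOfRecord₁₃ F N θ₀⟩)) p :=
  supplyChainAt_gaussPinH_of_ccmwCRZH_of_supplierBorel_of_betaBox (θ := Stage13HParams.ofHistoryBlind F N ⟨θ₀, ZrOfRecord₁₃ F N θ₀⟩) (by subst hθ₀; rfl)
    hjm hc2 hc8 hj hε hε' hB hB' ha₀ ha₁ hγ0 hγe h3γ hRγ hε3γ hε2γ h15 hc₁₅ (variationalThm1GaugeRegSepCoP7MGB_of_gauge9TopStepGB h9) hDat₀ hseam hbox hbox' hl hβ'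
    (provisos₁₃SepCoPH_door_ccmwCRZ_of_gauge9TopStepGB_of_betaBoxSignFree_allTorus_lam hθ₀ (by linarith) hc8 hγ0
      (hγe.trans (Real.exp_neg_one_lt_d9.le.trans (by norm_num))) hε hε' hB hB' ha₀ ha₁ h15 h9 (hAdm_floorGuard_ccmwCRZ hθ₀ hc₁₅) (fun θ' p n s δ W hn _ h => hDat₀ θ' p n s δ W hn h) hseam hbox hbox' hl hβ') p hw hsolv σ hσ hσB

/-- **★★★★ THEOREM 1 OF [III] ALONG THE RUN AND THE THEOREM OF p. 245 IN LAW FORM AT THE z-MEMBER's HISTORY-BLIND DOOR, KEY INCLUDED, PER WINDOW RUN** — from Part 14 §0c's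
K0-side letters + `2 ≤ c ≤ 8` + K0's per-cube [15]-solvability along the run + [III] §3's supplier at the run — NOTHING ELSE.  CONDITIONAL; nothing of Bałaban asserted.
[cite: Balaban1988Convergent, Thm 1 p.262, Theorem p.245, remark p.262, §3 p.279, (2.10) p.256, (2.28) p.259, (3.16)–(3.25) pp.268–270; Balaban1985Variational, Thm 1 (7)–(9) pp.278–279, (144)–(152) pp.300–301, Prop. 8 p.304; Balaban1987RG1, Thm 1 p.259, (0.20) p.256, (1.20)–(1.22) p.264; Balaban1989LargeFieldI, (0.2)–(0.4) p.176, p.177 (i)–(ii)] -/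
theorem thmP245Laws_gaussPinH_door_ccmwCRZ_of_supplierBorel_of_betaBox
    (hθ₀ : θ₀ = theta13LiveOfNumericsZ F N
      ({ stage12NumericsOfThm1CCMW F.L j γ ε₀ B₃ B₃' a₀ a₁ with s2 := { sect2NumericsOfThm1C F.L with cR := c } } : Stage12Numerics) ε₂₉
      (zeta316OfRecord F N (stage12NumericsOfThm1CCMW F.L j γ ε₀ B₃ B₃' a₀ a₁).ν (stage12NumericsOfThm1CCMW F.L j γ ε₀ B₃ B₃' a₀ a₁).τ9.M
        (stage12NumericsOfThm1CCMW F.L j γ ε₀ B₃ B₃' a₀ a₁).A₁) (RzOfRecord F N) (ZtOfRecord F N) Efl logz)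
    (hjm : j + 1 ≤ F.m) (hc2 : 2 ≤ c) (hc8 : c ≤ 8) (hj : 1 ≤ j) (hε : 0 < ε₀) (hε' : 0 < ε₂₉) (hB : 0 ≤ B₃) (hB' : 0 ≤ B₃') (ha₀ : 0 < a₀) (ha₁ : 0 < a₁)
    (hγ0 : 0 < γ) (hγe : γ ≤ Real.exp (-1))
    (h3γ : 3 * (F.L : ℝ) ^ j ≤ F.L * Real.log (γ ^ 2)⁻¹) (hRγ : ((8 * F.L + 3 : ℕ) : ℝ) ≤ F.L * Real.log (γ ^ 2)⁻¹)
    (hε3γ : 36608 * (γ * Real.log (γ ^ 2)⁻¹) ≤ 16 / 3) (hε2γ : γ * Real.log (γ ^ 2)⁻¹ ≤ 16 * ExpMeanLog.deltaSU (Fin N) / ((8 * F.L : ℕ) : ℝ) ^ 2)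
    (h15 : VariationalThm1RegSepCoP7MGB F N (floorGuard F c₁₅) (lamDatum F) Dat B₃ a₀ a₁) (hc₁₅ : c₁₅ ≤ F.L ^ j)
    (h9 : Gauge9RegSepTopStepGB F N (fun ν K Ω => suppDomOfRecord F ν K Ω) (F.L ^ j) (floorGuard F c₁₅) (lamDatum F) Dat B₃ B₃' a₀ a₁)
    (hDat₀ : ∀ (θ' : Stage13Params F N) (p : B12.RunParams) (n : ℕ) (s : SeqOfRecord F θ'.ν θ'.τ9.M (gOfRecord₁₃ F N θ' p) p.K n) (δ : ℕ → ℝ) (W : MSField (F.P p.K) (SU N)),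
      n ≤ p.K → Sect2.DataSmall7PTop (avOfRecord F N p.K) s.Ω (suppDomOfRecord F θ'.ν p.K s.Ω) n δ W → Dat p.K s.Ω (suppDomOfRecord F θ'.ν p.K s.Ω) n δ W)
    (hseam : ∀ (θ' : Stage13Params F N) (p : B12.RunParams) (n : ℕ) (s : SeqOfRecord F θ'.ν θ'.τ9.M (gOfRecord₁₃ F N θ' p) p.K (n + 1)) (W : MSField (F.P p.K) (SU N)),
      UbgOfRecord₁₃CoP F N θ' p (n + 1) s W = UbgMSCoPOfRecordB F N θ'.ν θ'.τ9.M (gOfRecord₁₃ F N θ' p) p.K (n + 1) s W)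
    (hbox : BetaLowerH bl γ (betaOfRecord₁₃ F N (theta13OfThm1CCMWZ F N j γ ε₀ ε₂₉ B₃ B₃' a₀ a₁ Efl logz)))
    (hbox' : BetaUpperH β' γ (betaOfRecord₁₃ F N (theta13OfThm1CCMWZ F N j γ ε₀ ε₂₉ B₃ B₃' a₀ a₁ Efl logz))) (hl : -bl * γ ^ 2 ≤ 3) (hβ' : β' * γ ^ 2 ≤ 3 / 4)
    (p : B12.RunParams) (hw : Step.InInterval γ p.K (gOfRecord₁₃ F N θ₀ p))
    (hsolv : ∀ i, 1 ≤ i → i ≤ p.K → ∀ (s : SeqOfRecord F θ₀.ν θ₀.τ9.M (gOfRecord₁₃ F N θ₀ p) p.K i) (V : GaugeField (F.P p.K) i (SU N)),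
      chiSeqOfRecord F N θ₀.ν θ₀.τ9.M (gOfRecord₁₃ F N θ₀ p) p.K i s V ≠ 0 →
      ∀ a ∈ cubesIn (fun a : ↥(cubeIndices (F.P p.K) (cubeSide (F.P p.K).L θ₀.ν.M₂ (RkOfRecord (F.P p.K).L θ₀.ν.r (gOfRecord₁₃ F N θ₀ p i)) i)) =>
          cubeEnl (F.P p.K) (cubeSide (F.P p.K).L θ₀.ν.M₂ (RkOfRecord (F.P p.K).L θ₀.ν.r (gOfRecord₁₃ F N θ₀ p i)) i) a 0) (s.Ω i),
        ∃ U₀, IsMinimizer (avOfRecord F N p.K) {U | PlaqSmall (θ₀.ν.εreg * (F.P p.K).eta i ^ 2) U}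
          (Bj θ₀.ν.M₁ (cubeEnl (F.P p.K) (cubeSide (F.P p.K).L θ₀.ν.M₂ (RkOfRecord (F.P p.K).L θ₀.ν.r (gOfRecord₁₃ F N θ₀ p i)) i) a 4) i)
          (avgFamily (avOfRecord F N p.K) (qsstarGIter0 i V)) U₀)
    (σ : Sect3Supplier (gaussPinH (Stage13HParams.ofHistoryBlind F N ⟨θ₀, ZrOfRecord₁₃ F N θ₀⟩)) p)
    (hσ : SupplierObligations (gaussPinH (Stage13HParams.ofHistoryBlind F N ⟨θ₀, ZrOfRecord₁₃ F N θ₀⟩)) p σ)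
    (hσB : SupplierBorel (gaussPinH (Stage13HParams.ofHistoryBlind F N ⟨θ₀, ZrOfRecord₁₃ F N θ₀⟩)) p σ) :
    (∀ k, k ≤ p.K → SLaw₁₃CoPH F N (gaussPinH (Stage13HParams.ofHistoryBlind F N ⟨θ₀, ZrOfRecord₁₃ F N θ₀⟩)) p k) ∧
    (∀ k, k < p.K → SLaw₁₃CoPH F N (gaussPinH (Stage13HParams.ofHistoryBlind F N ⟨θ₀, ZrOfRecord₁₃ F N θ₀⟩)) p k →
      TLaw₁₃CoPH F N (gaussPinH (Stage13HParams.ofHistoryBlind F N ⟨θ₀, ZrOfRecord₁₃ F N θ₀⟩)) p k) :=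
  thmP245Laws_gaussPinH_of_ccmwCRZH_of_supplierBorel_of_betaBox (θ := Stage13HParams.ofHistoryBlind F N ⟨θ₀, ZrOfRecord₁₃ F N θ₀⟩) (by subst hθ₀; rfl)
    hjm hc2 hc8 hj hε hε' hB hB' ha₀ ha₁ hγ0 hγe h3γ hRγ hε3γ hε2γ h15 hc₁₅ (variationalThm1GaugeRegSepCoP7MGB_of_gauge9TopStepGB h9) hDat₀ hseam hbox hbox' hl hβ'
    (provisos₁₃SepCoPH_door_ccmwCRZ_of_gauge9TopStepGB_of_betaBoxSignFree_allTorus_lam hθ₀ (by linarith) hc8 hγ0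
      (hγe.trans (Real.exp_neg_one_lt_d9.le.trans (by norm_num))) hε hε' hB hB' ha₀ ha₁ h15 h9 (hAdm_floorGuard_ccmwCRZ hθ₀ hc₁₅) (fun θ' p n s δ W hn _ h => hDat₀ θ' p n s δ W hn h) hseam hbox hbox' hl hβ') p hw hsolv σ hσ hσB

end Door

/-! ## §3  «γ sufficiently small» quantified at the door -/

section Window

/-- **★★★★ «γ SUFFICIENTLY SMALL» QUANTIFIED — THEOREM 1 OF [III] ALONG THE RUN AND THE THEOREM OF p. 245 IN LAW FORM AT THE z-MEMBER's HISTORY-BLIND DOOR, KEY INCLUDED, FOR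
EVERY cR-LETTERED z-MEMBER `c ∈ [2, 8]` AND EVERY WINDOW LETTER `γ ∈ ]0, γ₁₁ⁿᵘᵐ(L, j, N)]`** (`1 ≤ j`, `j + 1 ≤ F.m`): there is an explicit `γ₁₁ⁿᵘᵐ > 0` (p608030 §1) such that for every such
`γ`, `c`, [15]'s signs, (8), the (9)-step, the sign-free β-box and every run in the window with K0's per-cube [15]-solvability and a [III] §3 supplier, the laws hold at
`gaussPinH (ofHistoryBlind ⟨θ₁₃ᶻ(n_c, ε₂₉; Efl, logz), ZrOfRecord₁₃ …⟩)` — NOTHING ELSE displayed.  CONDITIONAL; nothing of Bałaban asserted.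
[cite: Balaban1988Convergent, Thm 1 p.262, Theorem p.245, §3 p.279, (2.4)–(2.5) p.255, (2.10) p.256, (2.28) p.259; Balaban1987RG1, Thm 1 p.259 («contained in an interval ]0, γ] with a sufficiently small positive γ»), (1.20)–(1.22) p.264; Balaban1989LargeFieldI, (0.2)–(0.4) p.176; Balaban1985Variational, Thm 1 (7)–(9) pp.278–279, (144)–(152) pp.300–301] -/
theorem exists_window_thmP245Laws_gaussPinH_door_ccmwCRZ (F : T4Family) (N : ℕ) [NeZero N] {j : ℕ} (hj : 1 ≤ j) (hjm : j + 1 ≤ F.m) (Efl logz : B12.RunParams → ℕ → ℝ) :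
    ∃ γ₀ : ℝ, 0 < γ₀ ∧ ∀ (Dat : TopData F N) (γ c ε₀ ε₂₉ B₃ B₃' a₀ a₁ bl β' : ℝ) (c₁₅ : ℕ), 2 ≤ c → c ≤ 8 → 0 < ε₀ → 0 < ε₂₉ → 0 ≤ B₃ → 0 ≤ B₃' → 0 < a₀ → 0 < a₁ → 0 < γ → γ ≤ γ₀ →
      VariationalThm1RegSepCoP7MGB F N (floorGuard F c₁₅) (lamDatum F) Dat B₃ a₀ a₁ → c₁₅ ≤ F.L ^ j → Gauge9RegSepTopStepGB F N (fun ν K Ω => suppDomOfRecord F ν K Ω) (F.L ^ j) (floorGuard F c₁₅) (lamDatum F) Dat B₃ B₃' a₀ a₁ →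
      (∀ (θ' : Stage13Params F N) (p : B12.RunParams) (n : ℕ) (s : SeqOfRecord F θ'.ν θ'.τ9.M (gOfRecord₁₃ F N θ' p) p.K n) (δ : ℕ → ℝ) (W : MSField (F.P p.K) (SU N)),
        n ≤ p.K → Sect2.DataSmall7PTop (avOfRecord F N p.K) s.Ω (suppDomOfRecord F θ'.ν p.K s.Ω) n δ W → Dat p.K s.Ω (suppDomOfRecord F θ'.ν p.K s.Ω) n δ W) →
      (∀ (θ' : Stage13Params F N) (p : B12.RunParams) (n : ℕ) (s : SeqOfRecord F θ'.ν θ'.τ9.M (gOfRecord₁₃ F N θ' p) p.K (n + 1)) (W : MSField (F.P p.K) (SU N)),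
        UbgOfRecord₁₃CoP F N θ' p (n + 1) s W = UbgMSCoPOfRecordB F N θ'.ν θ'.τ9.M (gOfRecord₁₃ F N θ' p) p.K (n + 1) s W) →
      BetaLowerH bl γ (betaOfRecord₁₃ F N (theta13OfThm1CCMWZ F N j γ ε₀ ε₂₉ B₃ B₃' a₀ a₁ Efl logz)) →
      BetaUpperH β' γ (betaOfRecord₁₃ F N (theta13OfThm1CCMWZ F N j γ ε₀ ε₂₉ B₃ B₃' a₀ a₁ Efl logz)) → -bl * γ ^ 2 ≤ 3 → β' * γ ^ 2 ≤ 3 / 4 →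
      ∀ (θ₀ : Stage13Params F N), θ₀ = theta13LiveOfNumericsZ F N
          ({ stage12NumericsOfThm1CCMW F.L j γ ε₀ B₃ B₃' a₀ a₁ with s2 := { sect2NumericsOfThm1C F.L with cR := c } } : Stage12Numerics) ε₂₉
          (zeta316OfRecord F N (stage12NumericsOfThm1CCMW F.L j γ ε₀ B₃ B₃' a₀ a₁).ν (stage12NumericsOfThm1CCMW F.L j γ ε₀ B₃ B₃' a₀ a₁).τ9.M
            (stage12NumericsOfThm1CCMW F.L j γ ε₀ B₃ B₃' a₀ a₁).A₁) (RzOfRecord F N) (ZtOfRecord F N) Efl logz →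
      ∀ (p : B12.RunParams), Step.InInterval γ p.K (gOfRecord₁₃ F N θ₀ p) →
      (∀ i, 1 ≤ i → i ≤ p.K → ∀ (s : SeqOfRecord F θ₀.ν θ₀.τ9.M (gOfRecord₁₃ F N θ₀ p) p.K i) (V : GaugeField (F.P p.K) i (SU N)),
        chiSeqOfRecord F N θ₀.ν θ₀.τ9.M (gOfRecord₁₃ F N θ₀ p) p.K i s V ≠ 0 →
        ∀ a ∈ cubesIn (fun a : ↥(cubeIndices (F.P p.K) (cubeSide (F.P p.K).L θ₀.ν.M₂ (RkOfRecord (F.P p.K).L θ₀.ν.r (gOfRecord₁₃ F N θ₀ p i)) i)) =>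
            cubeEnl (F.P p.K) (cubeSide (F.P p.K).L θ₀.ν.M₂ (RkOfRecord (F.P p.K).L θ₀.ν.r (gOfRecord₁₃ F N θ₀ p i)) i) a 0) (s.Ω i),
          ∃ U₀, IsMinimizer (avOfRecord F N p.K) {U | PlaqSmall (θ₀.ν.εreg * (F.P p.K).eta i ^ 2) U}
            (Bj θ₀.ν.M₁ (cubeEnl (F.P p.K) (cubeSide (F.P p.K).L θ₀.ν.M₂ (RkOfRecord (F.P p.K).L θ₀.ν.r (gOfRecord₁₃ F N θ₀ p i)) i) a 4) i)
            (avgFamily (avOfRecord F N p.K) (qsstarGIter0 i V)) U₀) →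
      ∀ (σ : Sect3Supplier (gaussPinH (Stage13HParams.ofHistoryBlind F N ⟨θ₀, ZrOfRecord₁₃ F N θ₀⟩)) p),
      SupplierObligations (gaussPinH (Stage13HParams.ofHistoryBlind F N ⟨θ₀, ZrOfRecord₁₃ F N θ₀⟩)) p σ →
      SupplierBorel (gaussPinH (Stage13HParams.ofHistoryBlind F N ⟨θ₀, ZrOfRecord₁₃ F N θ₀⟩)) p σ →
      (∀ k, k ≤ p.K → SLaw₁₃CoPH F N (gaussPinH (Stage13HParams.ofHistoryBlind F N ⟨θ₀, ZrOfRecord₁₃ F N θ₀⟩)) p k) ∧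
      (∀ k, k < p.K → SLaw₁₃CoPH F N (gaussPinH (Stage13HParams.ofHistoryBlind F N ⟨θ₀, ZrOfRecord₁₃ F N θ₀⟩)) p k →
        TLaw₁₃CoPH F N (gaussPinH (Stage13HParams.ofHistoryBlind F N ⟨θ₀, ZrOfRecord₁₃ F N θ₀⟩)) p k) := by
  obtain ⟨γ₀, hγ₀, hall⟩ := exists_window_ccmShape (L := F.L) F.hL.2.le j N
  refine ⟨γ₀, hγ₀, fun Dat γ c ε₀ ε₂₉ B₃ B₃' a₀ a₁ bl β' c₁₅ hc hc8 hε hε' hB hB' ha₀ ha₁ hγ hγle h15 hc₁₅ h9 hDat₀ hseam hbox hbox' hl hβ' θ₀ hθ₀ p hw hsolv σ hσ hσB => ?_⟩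
  obtain ⟨hγe, h3γ, hRγ, hε3γ, hε2γ⟩ := hall γ hγ hγle
  exact thmP245Laws_gaussPinH_door_ccmwCRZ_of_supplierBorel_of_betaBox hθ₀ hjm hc hc8 hj hε hε' hB hB' ha₀ ha₁ hγ hγe h3γ hRγ hε3γ hε2γ h15 hc₁₅ h9 hDat₀ hseam hbox hbox' hl hβ'
    p hw hsolv σ hσ hσB

end Window

end Summit.QuantumFields.YangMills.Theorems.BalabanUVNodesN11SupplyChainAtCRLetteredMemberOfBgFactsZB

end
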